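import Summits.NavierStokesRegularity.NavierStokesRegularity.Theorems.PerpetualPumpCircuitPumpClockBox
import Summits.NavierStokesRegularity.NavierStokesRegularity.Theorems.PerpetualPumpCircuitPumpTruncatedFlow
import Summits.NavierStokesRegularity.NavierStokesRegularity.Theorems.PerpetualPumpCircuitPumpClampCovering
import Summits.NavierStokesRegularity.NavierStokesRegularity.Theorems.PerpetualPumpCircuitPumpTruncationLimit
import Summits.NavierStokesRegularity.NavierStokesRegularity.Theorems.PerpetualPumpCircuitPumpDssExtension

/-!
# `PerpetualPump.CircuitPump` (stmt-NavierStokesRegularity-1834) — PROVED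

Tao's perpetual circuit pump exists: for every `lam₀ > 1` there are `lam ∈ (1, lam₀)`, a legal circuit
(symmetric, cyclic-cancelling coefficient table) and a nontrivial Type-I solution on `(-∞, 0)` that is
exactly discretely self-similar with period `k = 1` under `X ↦ lam^{1/5} X_{·,n+1}(lam^{-4/5} ·)`.

This is the sorry-free composition of line `singular-clock-gspt` (the lead's registered skeleton
`Cruxes/CircuitPump/Lines/singular-clock-gspt.lean`, theorem `CircuitPump_of`), written directly over the
five LANDED stubs:

* A `stub_clockBox` (`…ClockBox.lean`): the instance — the m = 2 SEEDED GRADED TODA PUMP at fine `lam`,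
  its Wazewski/clock box, window and a-priori bound (CoveringHyp);
* C1 `stub_truncatedFlow` + C2 `stub_clampCovering`: a relative periodic point of every finite truncation
  (continuous truncated flow on the box slice + the clamp/Schauder covering argument);
* D `stub_truncationLimit`: compactness in the truncation level ⇒ a one-period relative periodic orbit of
  the full lattice;
* E `stub_dssExtension`: unrolling by the scaling symmetry ⇒ the crux's DSS object with `k = 1`.
-/

set_option linter.dupNamespace false

noncomputable section

open Set

namespace Summit.NavierStokesRegularity.NavierStokesRegularity.Theorems.PerpetualPumpCircuitPump

/-- **`PerpetualPump.CircuitPump` holds.** A (clock box of the Toda pump) → C1 + C2 (relative periodic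
points of the truncations, flight times in `[Tmin, Tmax]` by the window at `A = x_{ia,0}`) → D (limit in the
truncation level) → E (DSS unrolling, `k = 1`); the final tuple is
`⟨lam, _, _, m, coeff, 1, X, IsSym, IsCyc, le_rfl, ODE, DSS, Type I, nontrivial⟩`. -/
theorem CircuitPump_proof :
    Summit.NavierStokesRegularity.NavierStokesRegularity.Theses.PerpetualPump.CircuitPump := by
  intro lam₀ hlam₀
  obtain ⟨lam, hlam, hlt, m, coeff, hS, hCy, lo, hi, Q, ia, ip, T₁, T₂, C, Tmin, Tmax, L₀, hip, hL₀, hbox,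
    hpos, hwin, hcov⟩ := stub_clockBox lam₀ hlam₀
  obtain ⟨hT₁c, hT₂c, hTmin, hwinA⟩ := hwin
  have hAmem : lo ia ∈ Icc (lo ia) (hi ia) := ⟨le_rfl, hbox.1 ia⟩
  have hTT : Tmin ≤ Tmax := by
    obtain ⟨h1, h2, h3⟩ := hwinA _ hAmem
    linarith
  have hTmax : 0 < Tmax := lt_of_lt_of_le hTmin hTT
  have hQ : ∀ n : ℤ, n ≠ 0 → IsCompact (Q n) := fun n hn => (hbox.2.1 n hn).1
  -- relative periodic points of the truncated lattices at every level (C1 + C2), then the limit (D)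
  obtain ⟨T, Z, hTmem, hsol, hwb, hin, hmatch⟩ :=
    stub_truncationLimit lam hlam m coeff lo hi Q C Tmin Tmax hTmin hTT hQ (by
      intro L'
      refine ⟨max L' L₀, le_max_left _ _, ?_⟩
      have hL : L₀ ≤ max L' L₀ := le_max_right _ _
      obtain ⟨Φ, hflow, hcont⟩ := stub_truncatedFlow lam hlam m coeff (max L' L₀) Tmax C
        {x | ((∀ i : Fin m, lo i ≤ x i 0 ∧ x i 0 ≤ hi i) ∧ ∀ n : ℤ, n ≠ 0 → (fun i => x i n) ∈ Q n) ∧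
          ∀ (i : Fin m) (n : ℤ), ((max L' L₀ : ℕ) : ℤ) < |n| → x i n = 0}
        hTmax (fun x hx => hx.2)
        (fun x hx T' Z' hT' hle hZ' => (hcov _ hL x hx.1 hx.2).1 T' Z' hT' hle hZ')
      obtain ⟨x, T, Z, hxin, -, hTmem, hsolZ, hwbZ, hmatchZ⟩ :=
        stub_clampCovering lam hlam m coeff lo hi Q ia ip T₁ T₂ C Tmin Tmax L₀ (max L' L₀) hip hL₀ hL
          hbox ⟨hT₁c, hT₂c, hTmin, hwinA⟩ (hcov _ hL) ⟨Φ, fun x hx hv => hflow x ⟨hx, hv⟩, hcont⟩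
      obtain ⟨h1, h2, h3⟩ := hwinA _ (hxin.1 ia)
      exact ⟨x, T, Z, hxin, ⟨le_trans h1 hTmem.1, le_trans hTmem.2 h3⟩, hsolZ, hwbZ, hmatchZ⟩)
  -- the one-period witness of the full lattice, unrolled (E)
  have hTpos : 0 < T := lt_of_lt_of_le hTmin hTmem.1
  have hlam0 : 0 < lam := by linarith
  obtain ⟨X, hode, hdss, htI, hnt⟩ := stub_dssExtension lam hlam m coeff T Z hTpos
    (fun i n t ht => (hsol i n t ⟨ht.1, le_trans ht.2 hTmem.2⟩).mono (Icc_subset_Icc le_rfl hTmem.2))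
    (fun i n => by rw [hmatch i n, ← mul_assoc, ← Real.rpow_add hlam0]; norm_num)
    ⟨C, fun i n t ht => hwb i n t ⟨ht.1, le_trans ht.2 hTmem.2⟩⟩
    ⟨ia, 0, ne_of_gt (lt_of_lt_of_le hpos (hin.1 ia).1)⟩
  exact ⟨lam, hlam, hlt, m, coeff, 1, X, hS, hCy, le_rfl, hode, hdss, htI, hnt⟩

end Summit.NavierStokesRegularity.NavierStokesRegularity.Theorems.PerpetualPumpCircuitPump
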